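import Summits.CriticalPhenomena.PercolationContinuityZ3.Theorems.PercNearOneGluingNoHeavyLowerTailAntipodalStrongHarris
import Summits.CriticalPhenomena.PercolationContinuityZ3.Theorems.PercNearOneGluingNoHeavyLowerTailKernelKleitman
import HarnessLib

/-!
# Graded antipodal Aas–Gladkov sums: the exact one-coordinate recursions (spanned coordinates; terminal–terminal edges)

Helper file for crux `stmt-CriticalPhenomena-4575` (`NoHeavyLowerTail`), unit `prim-gen-kcluster` gen 84
(memo `prim-gen-kcluster/KCLUSTER-gen84.md` §0.1, §2 (P1)).  Everything here is PROVED; no definitions, no named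
facts; vocabulary of `…AntipodalStrongHarris` (labels `Lab k`, pair weight `kappa`) and the set lemmas of
`…KernelKleitman`.

**Setting.**  The GRADED antipodal sum of two labelings `g h : Finset α → Lab k` with respect to a "rank" function
`ρ : Finset α → ℕ` at level `ℓ` is
`AG_ℓ(S; g, h, ρ) := Σ_{X ⊆ S, ρ X + ρ (S ∖ X) = ℓ} κ(g X, h (S ∖ X))`
(written out as `∑ X ∈ S.powerset, if ρ X + ρ (S \ X) = ℓ then kappa (g X) (h (S \ X)) else 0` below).
For a finite multigraph `G = (V, S)` with three terminals, `ρ X` = number of connected components of `(V, X)` and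
`g = h = f` the terminal-pattern labeling (`bot` = all apart, `petal i` = terminal `i` apart and the other two joined,
`top` = all joined), this is the level-`ℓ` antipodal Aas–Gladkov sum `AG_ℓ(G)` of the memos (`= 2(#N_ℓ − #B_ℓ)`),
whose nonnegativity for all `ℓ` ("F4_s", memo gen 83) is the graded strengthening of the tree's
`antipodalSum_self_nonneg` and is equivalent to the Aas–Gladkov inequality holding coefficientwise in `q` for the
random-cluster partition function.  Splitting off one coordinate `a ∉ S` (an edge of `G + a`):

* `gradedSum_insert` — the sum over `insert a S` is the sum over `X ⊆ S` of the two "face" terms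
  `κ(g X, h(a ∪ (S∖X)))` at level `ρ X + ρ(a ∪ (S∖X))` and `κ(g(a ∪ X), h(S∖X))` at level `ρ(a ∪ X) + ρ(S∖X)`.
* `gradedSum_insert_of_spanned` — if for every `X ⊆ S` the new coordinate is "spanned" on at least one side
  (`ρ` and the labels do not change when `a` is added to `X`, or do not change when it is added to `S ∖ X`; for graphs:
  `a` is a loop or has a parallel twin in `S`), then
  `AG_ℓ(insert a S; g, h, ρ) = AG_ℓ(S; g, h, ρ) + AG_ℓ(S; g ∘ insert a, h ∘ insert a, ρ ∘ insert a)`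
  (for graphs: `AG_ℓ(G) = AG_ℓ(G ∖ a) + AG_ℓ(G / a)`; graded AG reduces to simple graphs).
* `gradedSum_insert_of_terminalEdge` — if adding `a` to any `Y ⊆ S` either changes nothing and `Y` carries the
  label `petal p` or `top`, or lowers `ρ` by one while moving the label `bot ↦ petal p`, `petal i ↦ top` (`i ≠ p`)
  (for graphs: `a` joins the two terminals other than `p`; the first case is "`a` spanned by `Y`", the second "`a`
  joins two components of `Y`"), then `AG_ℓ(insert a S; f, f, ρ) = AG_ℓ(S; f, f, ρ) + #{X ⊆ S : both sides drop,
  level ℓ, κ(f X, f(S∖X)) = −1}`; in particular (`gradedSum_le_gradedSum_insert_of_terminalEdge`) the graded sum is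
  MONOTONE under adding a terminal–terminal edge: `AG_ℓ(G ∖ t_it_j) ≤ AG_ℓ(G)` for every level `ℓ`.
The proofs are termwise identities over `X ⊆ S` (the memo's "types 00/10/01 are harmless, type 11 is explicit here").
[this work]
-/

namespace Summit.CriticalPhenomena.PercolationContinuityZ3.Theorems

namespace AntipodalStrongHarris

open Lab Finset

variable {k : ℕ}

namespace Lab

/-- `κ` is symmetric. [this work] -/
theorem kappa_symm (u v : Lab k) : kappa u v = kappa v u := by
  rcases u with _ | i | _ <;> rcases v with _ | j | _ <;> simp [kappa, eq_comm]

/-- Two labels spanning the new edge (`petal p` or `top`) pair to `0`. [this work] -/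
theorem kappa_eq_zero_of_stays {p : Fin k} {u v : Lab k} (hu : u = petal p ∨ u = top)
    (hv : v = petal p ∨ v = top) : kappa u v = 0 := by
  rcases hu with rfl | rfl <;> rcases hv with rfl | rfl <;> simp [kappa]

/-- A spanning label against a moved label pairs to `0`. [this work] -/
theorem kappa_eq_zero_of_stays_moves {p : Fin k} {u v v' : Lab k} (hu : u = petal p ∨ u = top)
    (hv : (v = bot ∧ v' = petal p) ∨ ∃ i, i ≠ p ∧ v = petal i ∧ v' = top) : kappa u v' = 0 := by
  rcases hv with ⟨-, rfl⟩ | ⟨i, -, -, rfl⟩ <;> rcases hu with rfl | rfl <;> simp [kappa]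

/-- The two face terms of a set unspanned on both sides cancel. [this work] -/
theorem kappa_add_kappa_eq_zero_of_moves {p : Fin k} {u u' v v' : Lab k}
    (hu : (u = bot ∧ u' = petal p) ∨ ∃ i, i ≠ p ∧ u = petal i ∧ u' = top)
    (hv : (v = bot ∧ v' = petal p) ∨ ∃ i, i ≠ p ∧ v = petal i ∧ v' = top) :
    kappa u v' + kappa u' v = 0 := by
  rcases hu with ⟨rfl, rfl⟩ | ⟨i, hi, rfl, rfl⟩ <;> rcases hv with ⟨rfl, rfl⟩ | ⟨j, hj, rfl, rfl⟩
  · simp [kappa]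
  · simp [kappa, hj.symm]
  · simp [kappa, hi]
  · simp [kappa]

/-- Two unspanned labels pair to `0` or `-1`. [this work] -/
theorem kappa_eq_zero_or_of_moves {p : Fin k} {u u' v v' : Lab k}
    (hu : (u = bot ∧ u' = petal p) ∨ ∃ i, i ≠ p ∧ u = petal i ∧ u' = top)
    (hv : (v = bot ∧ v' = petal p) ∨ ∃ i, i ≠ p ∧ v = petal i ∧ v' = top) :
    kappa u v = 0 ∨ kappa u v = -1 := by
  rcases hu with ⟨rfl, -⟩ | ⟨i, -, rfl, -⟩ <;> rcases hv with ⟨rfl, -⟩ | ⟨j, -, rfl, -⟩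
  · simp [kappa]
  · simp [kappa]
  · simp [kappa]
  · by_cases h : i = j <;> simp [kappa, h]

end Lab

variable {α : Type*} [DecidableEq α]

/-- **Splitting off one coordinate.**  The graded sum over `insert a S` is the sum over `X ⊆ S` of the two face
terms (the coordinate `a` on the `h`-side resp. on the `g`-side), each at its own level. [this work] -/
theorem gradedSum_insert {S : Finset α} {a : α} (ha : a ∉ S) (g h : Finset α → Lab k) (ρ : Finset α → ℕ)
    (ℓ : ℕ) :
    (∑ X ∈ (insert a S).powerset,
        if ρ X + ρ (insert a S \ X) = ℓ then kappa (g X) (h (insert a S \ X)) else 0) =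
      ∑ X ∈ S.powerset,
        ((if ρ X + ρ (insert a (S \ X)) = ℓ then kappa (g X) (h (insert a (S \ X))) else 0) +
         (if ρ (insert a X) + ρ (S \ X) = ℓ then kappa (g (insert a X)) (h (S \ X)) else 0)) := by
  rw [sum_powerset_insert ha, ← sum_add_distrib]
  refine sum_congr rfl fun X hX => ?_
  rw [KernelKleitman.insert_sdiff_eq_insert_sdiff (mem_powerset.mp hX) ha,
    KernelKleitman.insert_sdiff_insert_eq ha]

/-- **Spanned coordinates are additive** (graphs: a loop, or an edge with a parallel twin).  If for every `X ⊆ S`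
adding `a` changes neither `ρ` nor the labels on the `X`-side, or changes nothing on the `S ∖ X`-side, then the
graded sum over `insert a S` is the "deletion" sum plus the "contraction" sum (labels and rank precomposed with
`insert a`), level by level. [this work] -/
theorem gradedSum_insert_of_spanned {S : Finset α} {a : α} (ha : a ∉ S) (g h : Finset α → Lab k)
    (ρ : Finset α → ℕ)
    (hsp : ∀ X, X ⊆ S →
      (ρ (insert a X) = ρ X ∧ g (insert a X) = g X ∧ h (insert a X) = h X) ∨
      (ρ (insert a (S \ X)) = ρ (S \ X) ∧ g (insert a (S \ X)) = g (S \ X) ∧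
        h (insert a (S \ X)) = h (S \ X)))
    (ℓ : ℕ) :
    (∑ X ∈ (insert a S).powerset,
        if ρ X + ρ (insert a S \ X) = ℓ then kappa (g X) (h (insert a S \ X)) else 0) =
      (∑ X ∈ S.powerset, if ρ X + ρ (S \ X) = ℓ then kappa (g X) (h (S \ X)) else 0) +
        ∑ X ∈ S.powerset,
          if ρ (insert a X) + ρ (insert a (S \ X)) = ℓ then
            kappa (g (insert a X)) (h (insert a (S \ X))) else 0 := by
  rw [gradedSum_insert ha, ← sum_add_distrib]
  refine sum_congr rfl fun X hX => ?_
  rcases hsp X (mem_powerset.mp hX) with ⟨h1, h2, _⟩ | ⟨h1, _, h3⟩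
  · rw [h1, h2, add_comm]
  · rw [h1, h3]

/-- **Terminal–terminal edges: the exact recursion.**  Suppose that for every `Y ⊆ S` adding `a` to `Y` either
changes neither `ρ Y` nor `f Y` and `f Y ∈ {petal p, top}` (the edge is spanned), or lowers `ρ` by one and moves the
label `bot ↦ petal p`, `petal i ↦ top` (`i ≠ p`).  Then the graded diagonal sum over `insert a S` equals the one over
`S` plus the number of `X ⊆ S` with `a` unspanned on both sides, level `ℓ`, and `κ(f X, f (S ∖ X)) = -1` (two
different petals). [this work] -/
theorem gradedSum_insert_of_terminalEdge {S : Finset α} {a : α} (ha : a ∉ S) (f : Finset α → Lab k)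
    (ρ : Finset α → ℕ) (p : Fin k)
    (hte : ∀ Y, Y ⊆ S →
      (ρ (insert a Y) = ρ Y ∧ f (insert a Y) = f Y ∧ (f Y = petal p ∨ f Y = top)) ∨
      (ρ (insert a Y) + 1 = ρ Y ∧
        ((f Y = bot ∧ f (insert a Y) = petal p) ∨ ∃ i, i ≠ p ∧ f Y = petal i ∧ f (insert a Y) = top)))
    (ℓ : ℕ) :
    (∑ X ∈ (insert a S).powerset,
        if ρ X + ρ (insert a S \ X) = ℓ then kappa (f X) (f (insert a S \ X)) else 0) =
      (∑ X ∈ S.powerset, if ρ X + ρ (S \ X) = ℓ then kappa (f X) (f (S \ X)) else 0) +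
        ((S.powerset.filter fun X => ρ (insert a X) + 1 = ρ X ∧ ρ (insert a (S \ X)) + 1 = ρ (S \ X) ∧
          ρ X + ρ (S \ X) = ℓ ∧ kappa (f X) (f (S \ X)) = -1).card : ℤ) := by
  rw [gradedSum_insert ha, card_filter, Nat.cast_sum, ← sum_add_distrib]
  refine sum_congr rfl fun X hX => ?_
  have hXS : X ⊆ S := mem_powerset.mp hX
  push_cast
  rcases hte X hXS with ⟨r1, l1, s1⟩ | ⟨r1, m1⟩ <;>
    rcases hte (S \ X) sdiff_subset with ⟨r2, l2, s2⟩ | ⟨r2, m2⟩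
  · -- both sides span `a`: every term vanishes
    have hP : ¬ (ρ (insert a X) + 1 = ρ X ∧ ρ (insert a (S \ X)) + 1 = ρ (S \ X) ∧
        ρ X + ρ (S \ X) = ℓ ∧ kappa (f X) (f (S \ X)) = -1) := fun h => by
      obtain ⟨h1, -, -, -⟩ := h; omega
    rw [if_neg hP, r1, l1, r2, l2, Lab.kappa_eq_zero_of_stays s1 s2]
    simp
  · -- `X` spans, the complement drops: the face term with `a` on the complement side vanishes
    have hP : ¬ (ρ (insert a X) + 1 = ρ X ∧ ρ (insert a (S \ X)) + 1 = ρ (S \ X) ∧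
        ρ X + ρ (S \ X) = ℓ ∧ kappa (f X) (f (S \ X)) = -1) := fun h => by
      obtain ⟨h1, -, -, -⟩ := h; omega
    rw [if_neg hP, r1, l1, Lab.kappa_eq_zero_of_stays_moves s1 m2]
    simp
  · -- `X` drops, the complement spans
    have hP : ¬ (ρ (insert a X) + 1 = ρ X ∧ ρ (insert a (S \ X)) + 1 = ρ (S \ X) ∧
        ρ X + ρ (S \ X) = ℓ ∧ kappa (f X) (f (S \ X)) = -1) := fun h => by
      obtain ⟨-, h2, -, -⟩ := h; omega
    rw [if_neg hP, r2, l2, Lab.kappa_symm (f (insert a X)) (f (S \ X)),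
      Lab.kappa_eq_zero_of_stays_moves s2 m1]
    simp
  · -- both sides drop: the face terms cancel, an old bad pair is compensated
    have hsum := Lab.kappa_add_kappa_eq_zero_of_moves m1 m2
    have hval := Lab.kappa_eq_zero_or_of_moves m1 m2
    by_cases hL : ρ (insert a X) + ρ (S \ X) = ℓ
    · have hF : ρ X + ρ (insert a (S \ X)) = ℓ := by omega
      have hD : ¬ ρ X + ρ (S \ X) = ℓ := by omega
      have hP : ¬ (ρ (insert a X) + 1 = ρ X ∧ ρ (insert a (S \ X)) + 1 = ρ (S \ X) ∧
          ρ X + ρ (S \ X) = ℓ ∧ kappa (f X) (f (S \ X)) = -1) := fun h => hD h.2.2.1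
      rw [if_pos hF, if_pos hL, if_neg hD, if_neg hP, hsum]
      simp
    · have hF : ¬ ρ X + ρ (insert a (S \ X)) = ℓ := by omega
      rw [if_neg hF, if_neg hL]
      by_cases hD : ρ X + ρ (S \ X) = ℓ
      · rw [if_pos hD]
        rcases hval with h0 | h1
        · have hP : ¬ (ρ (insert a X) + 1 = ρ X ∧ ρ (insert a (S \ X)) + 1 = ρ (S \ X) ∧
              ρ X + ρ (S \ X) = ℓ ∧ kappa (f X) (f (S \ X)) = -1) := fun h => by
            have h' := h.2.2.2; rw [h0] at h'; omega
          rw [if_neg hP, h0]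
        · have hP : (ρ (insert a X) + 1 = ρ X ∧ ρ (insert a (S \ X)) + 1 = ρ (S \ X) ∧
              ρ X + ρ (S \ X) = ℓ ∧ kappa (f X) (f (S \ X)) = -1) := ⟨r1, r2, hD, h1⟩
          rw [if_pos hP, h1]
          simp
      · have hP : ¬ (ρ (insert a X) + 1 = ρ X ∧ ρ (insert a (S \ X)) + 1 = ρ (S \ X) ∧
            ρ X + ρ (S \ X) = ℓ ∧ kappa (f X) (f (S \ X)) = -1) := fun h => hD h.2.2.1
        rw [if_neg hD, if_neg hP]

/-- **Graded antipodal AG is monotone under adding a terminal–terminal edge**: under the hypothesis of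
`gradedSum_insert_of_terminalEdge`, the level-`ℓ` graded diagonal sum over `S` is at most the one over
`insert a S`, for every level `ℓ` (graphs: `AG_ℓ(G ∖ t_it_j) ≤ AG_ℓ(G)`; so for the graded Aas–Gladkov conjecture
one may delete all terminal–terminal edges). [this work] -/
theorem gradedSum_le_gradedSum_insert_of_terminalEdge {S : Finset α} {a : α} (ha : a ∉ S)
    (f : Finset α → Lab k) (ρ : Finset α → ℕ) (p : Fin k)
    (hte : ∀ Y, Y ⊆ S →
      (ρ (insert a Y) = ρ Y ∧ f (insert a Y) = f Y ∧ (f Y = petal p ∨ f Y = top)) ∨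
      (ρ (insert a Y) + 1 = ρ Y ∧
        ((f Y = bot ∧ f (insert a Y) = petal p) ∨ ∃ i, i ≠ p ∧ f Y = petal i ∧ f (insert a Y) = top)))
    (ℓ : ℕ) :
    (∑ X ∈ S.powerset, if ρ X + ρ (S \ X) = ℓ then kappa (f X) (f (S \ X)) else 0) ≤
      ∑ X ∈ (insert a S).powerset,
        if ρ X + ρ (insert a S \ X) = ℓ then kappa (f X) (f (insert a S \ X)) else 0 := by
  rw [gradedSum_insert_of_terminalEdge ha f ρ p hte ℓ]
  simp only [le_add_iff_nonneg_right, Nat.cast_nonneg]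

end AntipodalStrongHarris

end Summit.CriticalPhenomena.PercolationContinuityZ3.Theorems
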